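import Mathlib.MeasureTheory.Measure.Decomposition.RadonNikodym
import Literature.Probability.LatticeModels.GibbsMeasureDensity
import Literature.Probability.LatticeModels.IsingGibbsFlip
import Literature.Probability.LatticeModels.CriticalGibbsUniqueness
import Literature.Probability.LatticeModels.PlusMinusStateGibbs
import Literature.Probability.LatticeModels.PlusFreeComparison
import HarnessLib

/-!
# Zero-field Ising Gibbs measures with the even correlations of `μ⁺` are mixtures of `μ⁺` and `μ⁻`

Topic `Probability/LatticeModels`, namespace `Literature.Probability.LatticeModels`. Theorem-only file
(no definitions, no named facts). For the nearest-neighbour Ising model on `ℤ^d` at `β ≥ 0`: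

* `eq_smul_of_dlr_of_le_plus` / `eq_smul_of_dlr_of_le_minus` — **extremality of the plus and
  minus states, in concrete form**: a finite measure `κ` which satisfies the DLR equations and is
  dominated by the plus state `μ⁺` (resp. `μ⁻`), `κ ≤ μ⁺` as measures, is the multiple
  `κ(Ω) μ⁺` (resp. `κ(Ω) μ⁻`). This is the statement "`μ⁺_{β,h}`, `μ⁻_{β,h}` are extremal" of
  Friedli–Velenik 2017, Thm. 6.63 (2) / Lemma 6.65 with eq. (6.70) (Georgii 2011, Cor. 7.4 and
  §6.2; Ellis 2006, proof of Thm. IV.6.5 (b), p. 153), proved by the FKG sandwich on the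
  increasing cylinder events `{σ_B ≡ +1}`: `κ(E) = ∫ μ^η_Λ(E) κ(dη) ≤ κ(Ω) μ⁺_Λ(E)` and
  `(μ⁺ - κ)(E) ≤ (1 - κ(Ω)) μ⁺_Λ(E)`, with `μ⁺_Λ(E) → μ⁺(E)`; two finite measures agreeing on this
  `π`-system are equal.
* `eq_mixture_of_even_spinCorr_eq` and `exists_eq_mixture_of_even_spinCorr_eq_plusCorr` — **a
  Gibbs measure `μ ∈ 𝒢(β, 0)` all of whose even correlations are those of `μ⁺`,
  `⟨σ_A⟩_μ = ⟨σ_A⟩⁺_{β,0}` for `|A|` even, is a mixture `t μ⁺ + (1-t) μ⁻`, `t ∈ [0,1]`.** This is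
  the last step of Lebowitz' route to the structure of translation invariant states (J. L.
  Lebowitz, J. Stat. Phys. 16 (1977) 463–476, §3, Thm. 3 and Remark (iii), p. 472: equality of the
  even correlations with those of `μ₊` leaves only the mixtures `λμ₊ + (1-λ)μ₋`; for the symmetric
  state this is his Remark (ii), "`μ₀ = ½(μ₊ + μ₋)`"). Proof: the flipped measure `μ∘flip⁻¹` is
  Gibbs (`IsingGibbsFlip`), and `½(μ + μ∘flip⁻¹)`, `½(μ⁺ + μ⁻)` are probability measures with the
  same correlations (even ones `= ⟨σ_A⟩⁺`, odd ones `= 0`), hence equal (Friedli–Velenik 2017,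
  Lemma 3.19); so `μ ≤ μ⁺ + μ⁻ =: ρ`, `μ = g·ρ`, and by `GibbsMeasureDensity` the pieces `g·μ⁺`,
  `g·μ⁻` are DLR measures dominated by `μ⁺`, `μ⁻`, hence multiples of them.

Supporting bookkeeping: correlations of sums and multiples of measures, the probability of
`{σ_B ≡ +1}` as `2^{-|B|} ∑_{D ⊆ B} ⟨σ_D⟩` (Friedli–Velenik 2017, Lemma 3.19), and the convergence
`μ^±_{B(L)}(σ_B ≡ +1) → μ^±(σ_B ≡ +1)` (Thm. 3.17).

## Mathlib status

Anchors: `Measure.rnDeriv`, `Measure.withDensity_rnDeriv_eq`, `Measure.rnDeriv_le_one_of_le`,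
`withDensity_add_measure`, `withDensity_mono`, `withDensity_one`, `ext_of_generate_finite`,
`integral_mono_measure`, `integral_toReal`, `le_of_tendsto_of_tendsto'`; tree:
`measure_eq_of_forall_spinCorr_eq`, `measureReal_forall_eq_one_fixed_le_plus/minus_le_fixed`,
`generateFrom_range_forall_eq_one`, `isPiSystem_range_forall_eq_one`
(`CriticalGibbsUniqueness.lean`), `tendsto_isingCorr_plus_box/minus_box`,
`exists_plusMeasure_holds/minusMeasure_holds` (`PlusMinusStateGibbs.lean`),
`plusIndicator_eq_sum_spinProduct` (`PlusFreeComparison.lean`),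
`IsSpecification.dlr_withDensity_of_absolutelyContinuous` (`GibbsMeasureDensity.lean`),
`isGibbsMeasure_map_neg` (`IsingGibbsFlip.lean`).

## References

* J. L. Lebowitz, *Coexistence of phases in Ising ferromagnets*, J. Stat. Phys. 16 (1977)
  463–476, §3, Thm. 3, Remarks (ii)–(iii).
* S. Friedli, Y. Velenik, *Statistical Mechanics of Lattice Systems*, CUP (2017), Lemma 3.19,
  Thm. 3.17, §3.7.1, Thm. 6.63, Lemma 6.65, eq. (6.70).
* H.-O. Georgii, *Gibbs Measures and Phase Transitions*, 2nd ed. (2011), §6.2, §7.1 (Cor. 7.4,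
  Thm. 7.7).
* R. S. Ellis, *Entropy, Large Deviations, and Statistical Mechanics*, Springer (2006),
  Thm. IV.6.5 and its proof, p. 153.
-/

noncomputable section

open MeasureTheory Filter Topology Finset ProbabilityTheory
open scoped ENNReal

namespace Literature.Probability.LatticeModels

/-! ### Correlations of sums and multiples; the events `{σ_B ≡ +1}` -/

section Bookkeeping

variable {V : Type*}

/-- `⟨σ_A⟩_{μ+ν} = ⟨σ_A⟩_μ + ⟨σ_A⟩_ν` for finite measures (linearity of the integral in the
measure). [folklore] -/
theorem spinCorr_add (μ ν : Measure (SpinConfig V)) [IsFiniteMeasure μ] [IsFiniteMeasure ν]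
    (A : Finset V) : spinCorr (μ + ν) A = spinCorr μ A + spinCorr ν A :=
  integral_add_measure (integrable_spinProduct μ A) (integrable_spinProduct ν A)

/-- `⟨σ_A⟩_{c μ} = c ⟨σ_A⟩_μ` for `c ∈ [0, ∞]` (with `∞ ↦ 0`, Mathlib's `toReal` convention). [folklore] -/
theorem spinCorr_smul (c : ℝ≥0∞) (μ : Measure (SpinConfig V)) (A : Finset V) :
    spinCorr (c • μ) A = c.toReal * spinCorr μ A := by
  rw [spinCorr, spinCorr, integral_smul_measure, smul_eq_mul]

/-- The probability of `{σ_B ≡ +1}` is the expectation of `n_B = ∏_{i ∈ B} (1 + σ_i)/2`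
(Friedli–Velenik 2017, §3.6.2, p. 107). [cite: FriedliVelenik2017, §3.6.2, p. 107] -/
theorem measureReal_forall_eq_one_eq_integral_plusIndicator (μ : Measure (SpinConfig V))
    (B : Finset V) :
    μ.real {σ : SpinConfig V | ∀ i ∈ B, σ i = 1} = ∫ σ, plusIndicator B σ ∂μ := by
  rw [← integral_indicator_one (measurableSet_forall_eq_one B)]
  congr 1
  funext σ
  rw [plusIndicator_eq]
  by_cases h : ∀ i ∈ B, σ i = 1
  · rw [Set.indicator_of_mem (show σ ∈ {σ : SpinConfig V | ∀ i ∈ B, σ i = 1} from h), if_pos h,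
      Pi.one_apply]
  · rw [Set.indicator_of_notMem (show σ ∉ {σ : SpinConfig V | ∀ i ∈ B, σ i = 1} from h), if_neg h]

/-- `∫ n_B dμ = 2^{-|B|} ∑_{D ⊆ B} ⟨σ_D⟩_μ` for a finite measure (Friedli–Velenik 2017, Lemma 3.19,
`n_B = 2^{-|B|} ∑_{D ⊆ B} σ_D`). [cite: FriedliVelenik2017, Lemma 3.19] -/
theorem integral_plusIndicator_eq_sum_spinCorr [DecidableEq V] (μ : Measure (SpinConfig V))
    [IsFiniteMeasure μ] (B : Finset V) :
    ∫ σ, plusIndicator B σ ∂μ = ((2 : ℝ) ^ #B)⁻¹ * ∑ D ∈ B.powerset, spinCorr μ D := by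
  have hfun : plusIndicator (V := V) B =
      fun σ => ((2 : ℝ) ^ #B)⁻¹ * ∑ D ∈ B.powerset, spinProduct D σ :=
    funext (plusIndicator_eq_sum_spinProduct B)
  rw [hfun, integral_const_mul, integral_finsetSum _ fun D _ => integrable_spinProduct μ D]
  rfl

/-- Hence `μ(σ_B ≡ +1) = 2^{-|B|} ∑_{D ⊆ B} ⟨σ_D⟩_μ` (Friedli–Velenik 2017, Lemma 3.19). [cite: FriedliVelenik2017, Lemma 3.19] -/
theorem measureReal_forall_eq_one_eq_sum_spinCorr [DecidableEq V] (μ : Measure (SpinConfig V))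
    [IsFiniteMeasure μ] (B : Finset V) :
    μ.real {σ : SpinConfig V | ∀ i ∈ B, σ i = 1} =
      ((2 : ℝ) ^ #B)⁻¹ * ∑ D ∈ B.powerset, spinCorr μ D := by
  rw [measureReal_forall_eq_one_eq_integral_plusIndicator, integral_plusIndicator_eq_sum_spinCorr]

end Bookkeeping

/-! ### The plus and minus states dominate and are approximated on `{σ_B ≡ +1}` -/

section PlusMinus

variable {d : ℕ}

/-- **`μ⁺_{B(L);β,h}(σ_B ≡ +1) → μ⁺_{β,h}(σ_B ≡ +1)`** for `β ≥ 0`, `h ∈ ℝ`, where `μ⁺_{β,h}` is any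
measure with the plus correlations `⟨σ_D⟩ = plusCorr d β h D` (Friedli–Velenik 2017, Thm. 3.17
with Lemma 3.19: both sides are `2^{-|B|} ∑_{D⊆B} ⟨σ_D⟩`). [cite: FriedliVelenik2017, Thm. 3.17 and Lemma 3.19] -/
theorem tendsto_measureReal_forall_eq_one_plus_box {β : ℝ} (hβ : 0 ≤ β) (h : ℝ)
    {μp : Measure (SpinConfig (Site d))} [IsFiniteMeasure μp]
    (hp : ∀ A : Finset (Site d), spinCorr μp A = plusCorr d β h A) (B : Finset (Site d)) :
    Tendsto (fun L : ℕ => (isingMeasure (zdGraph d) (box d L) β h .plus).real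
        {σ : SpinConfig (Site d) | ∀ i ∈ B, σ i = 1}) atTop
      (𝓝 (μp.real {σ : SpinConfig (Site d) | ∀ i ∈ B, σ i = 1})) := by
  have h2 : μp.real {σ : SpinConfig (Site d) | ∀ i ∈ B, σ i = 1} =
      ((2 : ℝ) ^ #B)⁻¹ * ∑ D ∈ B.powerset, plusCorr d β h D := by
    rw [measureReal_forall_eq_one_eq_sum_spinCorr]
    simp_rw [hp]
  rw [h2]
  simp_rw [measureReal_forall_eq_one_eq_sum_spinCorr]
  exact (tendsto_finsetSum _ fun D _ => tendsto_isingCorr_plus_box hβ h D).const_mul _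

/-- **`μ⁻_{B(L);β,h}(σ_B ≡ +1) → μ⁻_{β,h}(σ_B ≡ +1)`** for `β ≥ 0`, `h ∈ ℝ`, where `μ⁻_{β,h}` is any
measure with the minus correlations (Friedli–Velenik 2017, Thm. 3.17 with Lemma 3.19). [cite: FriedliVelenik2017, Thm. 3.17 and Lemma 3.19] -/
theorem tendsto_measureReal_forall_eq_one_minus_box {β : ℝ} (hβ : 0 ≤ β) (h : ℝ)
    {μm : Measure (SpinConfig (Site d))} [IsFiniteMeasure μm]
    (hm : ∀ A : Finset (Site d), spinCorr μm A = minusCorr d β h A) (B : Finset (Site d)) :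
    Tendsto (fun L : ℕ => (isingMeasure (zdGraph d) (box d L) β h .minus).real
        {σ : SpinConfig (Site d) | ∀ i ∈ B, σ i = 1}) atTop
      (𝓝 (μm.real {σ : SpinConfig (Site d) | ∀ i ∈ B, σ i = 1})) := by
  have h2 : μm.real {σ : SpinConfig (Site d) | ∀ i ∈ B, σ i = 1} =
      ((2 : ℝ) ^ #B)⁻¹ * ∑ D ∈ B.powerset, minusCorr d β h D := by
    rw [measureReal_forall_eq_one_eq_sum_spinCorr]
    simp_rw [hm]
  rw [h2]
  simp_rw [measureReal_forall_eq_one_eq_sum_spinCorr]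
  exact (tendsto_finsetSum _ fun D _ => tendsto_isingCorr_minus_box hβ h D).const_mul _

/-- The DLR equation for a finite measure `κ` on an event `E`, in real form:
`κ(E) = ∫ μ^η_{Λ;β,h}(E) κ(dη)` (Friedli–Velenik 2017, Def. 6.13 / eq. (6.70)). [cite: FriedliVelenik2017, Def. 6.13] -/
theorem measureReal_eq_integral_of_dlr {β h : ℝ} {κ : Measure (SpinConfig (Site d))}
    [IsFiniteMeasure κ]
    (hκ : ∀ (Λ : Finset (Site d)) (A : Set (SpinConfig (Site d))), MeasurableSet A →
      ∫⁻ η, isingSpecification (zdGraph d) β h Λ η A ∂κ = κ A)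
    (Λ : Finset (Site d)) {E : Set (SpinConfig (Site d))} (hE : MeasurableSet E) :
    κ.real E = ∫ η, (isingMeasure (zdGraph d) Λ β h (.fixed η)).real E ∂κ := by
  have hγ : IsSpecification (isingSpecification (zdGraph d) β h) :=
    isSpecification_isingSpecification_holds (zdGraph d) β h
  have hm : Measurable fun η : SpinConfig (Site d) => isingMeasure (zdGraph d) Λ β h (.fixed η) E :=
    hγ.measurable_coe Λ hE
  have hκ' : ∫⁻ η, isingMeasure (zdGraph d) Λ β h (.fixed η) E ∂κ = κ E := hκ Λ E hE
  simp_rw [measureReal_def]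
  rw [← hκ', integral_toReal hm.aemeasurable (Eventually.of_forall fun η => measure_lt_top _ _)]

/-- **Extremality of the plus state (Friedli–Velenik 2017, Thm. 6.63 (2) / Lemma 6.65; Georgii 2011,
Cor. 7.4; Ellis 2006, proof of Thm. IV.6.5 (b), p. 153), in concrete form**: for `β ≥ 0` and any
`h`, let `μ⁺ ∈ 𝒢(β,h)` be the plus state (the Gibbs measure with correlations `plusCorr d β h`). If
a finite measure `κ` satisfies the DLR equations for the Ising specification at `(β,h)` and
`κ ≤ μ⁺`, then `κ = κ(Ω) μ⁺`. Proof: for `E = {σ_B ≡ +1}` and every box `Λ`,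
`κ(E) = ∫ μ^η_Λ(E) dκ ≤ κ(Ω) μ⁺_Λ(E)` and `μ⁺(E) - κ(E) = ∫ μ^η_Λ(E) d(μ⁺ - κ) ≤ (1-κ(Ω)) μ⁺_Λ(E)`
(FKG: `μ^η_Λ(E) ≤ μ⁺_Λ(E)`, Lemma 3.23; and `μ⁺ - κ ≥ 0`); letting `Λ ↑ ℤ^d`, `μ⁺_Λ(E) → μ⁺(E)`
(Thm. 3.17), so `κ(E) = κ(Ω) μ⁺(E)`; the events `E` form a `π`-system generating the
`σ`-algebra. [cite: FriedliVelenik2017, Thm. 6.63 and Lemma 6.65, eq. (6.70)] -/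
theorem eq_smul_of_dlr_of_le_plus {β : ℝ} (hβ : 0 ≤ β) (h : ℝ)
    {μp : Measure (SpinConfig (Site d))}
    (hμp : IsGibbsMeasure (isingSpecification (zdGraph d) β h) μp)
    (hp : ∀ A : Finset (Site d), spinCorr μp A = plusCorr d β h A)
    {κ : Measure (SpinConfig (Site d))}
    (hκ : ∀ (Λ : Finset (Site d)) (A : Set (SpinConfig (Site d))), MeasurableSet A →
      ∫⁻ η, isingSpecification (zdGraph d) β h Λ η A ∂κ = κ A)
    (hle : κ ≤ μp) : κ = κ Set.univ • μp := by
  haveI := hμp.isProbabilityMeasure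
  haveI : IsFiniteMeasure κ := ⟨(hle Set.univ).trans_lt (measure_lt_top _ _)⟩
  have hγ : IsSpecification (isingSpecification (zdGraph d) β h) :=
    isSpecification_isingSpecification_holds (zdGraph d) β h
  have key : ∀ B : Finset (Site d), κ.real {σ : SpinConfig (Site d) | ∀ i ∈ B, σ i = 1} =
      κ.real Set.univ * μp.real {σ : SpinConfig (Site d) | ∀ i ∈ B, σ i = 1} := by
    intro B
    set E : Set (SpinConfig (Site d)) := {σ | ∀ i ∈ B, σ i = 1} with hEdef
    have hE : MeasurableSet E := measurableSet_forall_eq_one B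
    -- the finite-volume conditional probabilities `F_L(η) = μ^η_{B(L)}(E)` and their bounds
    set c : ℝ := κ.real Set.univ with hcdef
    set F : ℕ → SpinConfig (Site d) → ℝ := fun L η =>
      (isingMeasure (zdGraph d) (box d L) β h (.fixed η)).real E with hFdef
    set M : ℕ → ℝ := fun L => (isingMeasure (zdGraph d) (box d L) β h .plus).real E with hMdef
    have hFM : ∀ L η, F L η ≤ M L := fun L η =>
      measureReal_forall_eq_one_fixed_le_plus (zdGraph d) hβ (box d L) h η B
    have hFm : ∀ L, Measurable (F L) := fun L => (hγ.measurable_coe (box d L) hE).ennreal_toReal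
    have hFi : ∀ (ν : Measure (SpinConfig (Site d))) [IsFiniteMeasure ν] (L : ℕ), Integrable (F L) ν :=
      fun ν _ L => Integrable.of_bound (hFm L).aestronglyMeasurable 1 (Eventually.of_forall fun η => by
        rw [Real.norm_eq_abs, abs_of_nonneg measureReal_nonneg]
        exact measureReal_le_one)
    have hκF : ∀ L, κ.real E = ∫ η, F L η ∂κ := fun L => measureReal_eq_integral_of_dlr hκ (box d L) hE
    have hpF : ∀ L, μp.real E = ∫ η, F L η ∂μp := fun L =>
      measureReal_eq_integral_of_dlr hμp.2 (box d L) hE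
    -- (b) `κ(E) ≤ κ(Ω) μ⁺_Λ(E)`
    have hb : ∀ L, κ.real E ≤ c * M L := fun L => by
      rw [hκF L]
      calc ∫ η, F L η ∂κ ≤ ∫ _, M L ∂κ := integral_mono (hFi κ L) (integrable_const _) (hFM L)
        _ = c * M L := by rw [integral_const, smul_eq_mul]
    -- (c) `μ⁺(E) - κ(E) ≤ (1 - κ(Ω)) μ⁺_Λ(E)`
    have hc : ∀ L, c * M L - κ.real E ≤ M L - μp.real E := fun L => by
      have h1 : ∫ η, (M L - F L η) ∂κ ≤ ∫ η, (M L - F L η) ∂μp :=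
        integral_mono_measure hle (Eventually.of_forall fun η => sub_nonneg.2 (hFM L η))
          ((integrable_const _).sub (hFi μp L))
      rw [integral_sub (integrable_const _) (hFi κ L), integral_sub (integrable_const _) (hFi μp L),
        integral_const, integral_const, smul_eq_mul, smul_eq_mul, ← hκF L, ← hpF L] at h1
      simp only [probReal_univ, one_mul] at h1
      exact h1
    -- `L → ∞`
    have hlim : Tendsto M atTop (𝓝 (μp.real E)) := tendsto_measureReal_forall_eq_one_plus_box hβ h hp B
    have hup : κ.real E ≤ c * μp.real E := ge_of_tendsto' (hlim.const_mul c) hb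
    have hdown : c * μp.real E - κ.real E ≤ μp.real E - μp.real E :=
      le_of_tendsto_of_tendsto' ((hlim.const_mul c).sub_const _) (hlim.sub_const _) hc
    linarith
  refine ext_of_generate_finite _ generateFrom_range_forall_eq_one isPiSystem_range_forall_eq_one
    ?_ ?_
  · rintro _ ⟨B, rfl⟩
    dsimp only
    rw [Measure.smul_apply, smul_eq_mul, ← ofReal_measureReal (measure_ne_top κ _), key B,
      ENNReal.ofReal_mul measureReal_nonneg, ofReal_measureReal (measure_ne_top κ _),
      ofReal_measureReal (measure_ne_top μp _)]
  · rw [Measure.smul_apply, smul_eq_mul, show μp Set.univ = 1 from measure_univ, mul_one]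

/-- **Extremality of the minus state, in concrete form** (Friedli–Velenik 2017, Thm. 6.63 (2) /
Lemma 6.65; Georgii 2011, Cor. 7.4): for `β ≥ 0` and any `h`, if a finite measure `κ` satisfies
the DLR equations at `(β,h)` and `κ ≤ μ⁻`, the minus state, then `κ = κ(Ω) μ⁻` — by the lower
FKG bound `μ⁻_Λ(E) ≤ μ^η_Λ(E)` on `E = {σ_B ≡ +1}` and `μ⁻_Λ(E) → μ⁻(E)`. [cite: FriedliVelenik2017, Thm. 6.63 and Lemma 6.65, eq. (6.70)] -/
theorem eq_smul_of_dlr_of_le_minus {β : ℝ} (hβ : 0 ≤ β) (h : ℝ)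
    {μm : Measure (SpinConfig (Site d))}
    (hμm : IsGibbsMeasure (isingSpecification (zdGraph d) β h) μm)
    (hm : ∀ A : Finset (Site d), spinCorr μm A = minusCorr d β h A)
    {κ : Measure (SpinConfig (Site d))}
    (hκ : ∀ (Λ : Finset (Site d)) (A : Set (SpinConfig (Site d))), MeasurableSet A →
      ∫⁻ η, isingSpecification (zdGraph d) β h Λ η A ∂κ = κ A)
    (hle : κ ≤ μm) : κ = κ Set.univ • μm := by
  haveI := hμm.isProbabilityMeasure
  haveI : IsFiniteMeasure κ := ⟨(hle Set.univ).trans_lt (measure_lt_top _ _)⟩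
  have hγ : IsSpecification (isingSpecification (zdGraph d) β h) :=
    isSpecification_isingSpecification_holds (zdGraph d) β h
  have key : ∀ B : Finset (Site d), κ.real {σ : SpinConfig (Site d) | ∀ i ∈ B, σ i = 1} =
      κ.real Set.univ * μm.real {σ : SpinConfig (Site d) | ∀ i ∈ B, σ i = 1} := by
    intro B
    set E : Set (SpinConfig (Site d)) := {σ | ∀ i ∈ B, σ i = 1} with hEdef
    have hE : MeasurableSet E := measurableSet_forall_eq_one B
    set c : ℝ := κ.real Set.univ with hcdef
    set F : ℕ → SpinConfig (Site d) → ℝ := fun L η =>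
      (isingMeasure (zdGraph d) (box d L) β h (.fixed η)).real E with hFdef
    set m : ℕ → ℝ := fun L => (isingMeasure (zdGraph d) (box d L) β h .minus).real E with hmdef
    have hmF : ∀ L η, m L ≤ F L η := fun L η =>
      measureReal_forall_eq_one_minus_le_fixed (zdGraph d) hβ (box d L) h η B
    have hFm : ∀ L, Measurable (F L) := fun L => (hγ.measurable_coe (box d L) hE).ennreal_toReal
    have hFi : ∀ (ν : Measure (SpinConfig (Site d))) [IsFiniteMeasure ν] (L : ℕ), Integrable (F L) ν :=
      fun ν _ L => Integrable.of_bound (hFm L).aestronglyMeasurable 1 (Eventually.of_forall fun η => by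
        rw [Real.norm_eq_abs, abs_of_nonneg measureReal_nonneg]
        exact measureReal_le_one)
    have hκF : ∀ L, κ.real E = ∫ η, F L η ∂κ := fun L => measureReal_eq_integral_of_dlr hκ (box d L) hE
    have hmF' : ∀ L, μm.real E = ∫ η, F L η ∂μm := fun L =>
      measureReal_eq_integral_of_dlr hμm.2 (box d L) hE
    -- (b) `κ(E) ≥ κ(Ω) μ⁻_Λ(E)`
    have hb : ∀ L, c * m L ≤ κ.real E := fun L => by
      rw [hκF L]
      calc c * m L = ∫ _, m L ∂κ := by rw [integral_const, smul_eq_mul]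
        _ ≤ ∫ η, F L η ∂κ := integral_mono (integrable_const _) (hFi κ L) (hmF L)
    -- (c) `κ(E) - κ(Ω) μ⁻_Λ(E) ≤ μ⁻(E) - μ⁻_Λ(E)`
    have hc : ∀ L, κ.real E - c * m L ≤ μm.real E - m L := fun L => by
      have h1 : ∫ η, (F L η - m L) ∂κ ≤ ∫ η, (F L η - m L) ∂μm :=
        integral_mono_measure hle (Eventually.of_forall fun η => sub_nonneg.2 (hmF L η))
          ((hFi μm L).sub (integrable_const _))
      rw [integral_sub (hFi κ L) (integrable_const _), integral_sub (hFi μm L) (integrable_const _),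
        integral_const, integral_const, smul_eq_mul, smul_eq_mul, ← hκF L, ← hmF' L] at h1
      simp only [probReal_univ, one_mul] at h1
      exact h1
    have hlim : Tendsto m atTop (𝓝 (μm.real E)) := tendsto_measureReal_forall_eq_one_minus_box hβ h hm B
    have hdown : c * μm.real E ≤ κ.real E := le_of_tendsto' (hlim.const_mul c) hb
    have hup : κ.real E - c * μm.real E ≤ μm.real E - μm.real E :=
      le_of_tendsto_of_tendsto' (tendsto_const_nhds.sub (hlim.const_mul c)) (hlim.const_sub _) hc
    linarith
  refine ext_of_generate_finite _ generateFrom_range_forall_eq_one isPiSystem_range_forall_eq_one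
    ?_ ?_
  · rintro _ ⟨B, rfl⟩
    dsimp only
    rw [Measure.smul_apply, smul_eq_mul, ← ofReal_measureReal (measure_ne_top κ _), key B,
      ENNReal.ofReal_mul measureReal_nonneg, ofReal_measureReal (measure_ne_top κ _),
      ofReal_measureReal (measure_ne_top μm _)]
  · rw [Measure.smul_apply, smul_eq_mul, show μm Set.univ = 1 from measure_univ, mul_one]

end PlusMinus

/-! ### Gibbs measures with the even correlations of `μ⁺` are mixtures of `μ⁺` and `μ⁻` -/

section Mixture

variable {d : ℕ}

/-- **Lebowitz 1977, §3, Thm. 3 / Remark (iii) (last step), proved**: for the nearest-neighbour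
Ising model on `ℤ^d` at `β ≥ 0` and zero field, let `μ⁺, μ⁻ ∈ 𝒢(β,0)` be the plus and minus states
(Gibbs measures with the correlations `plusCorr`, `minusCorr`). If `μ ∈ 𝒢(β,0)` has the even
correlations of `μ⁺`, `⟨σ_A⟩_μ = ⟨σ_A⟩⁺_{β,0}` for all `|A|` even, then `μ = t μ⁺ + (1-t) μ⁻` for some
`t ∈ [0,1]`. Proof: `μ∘flip⁻¹ ∈ 𝒢(β,0)` and `μ + μ∘flip⁻¹ = μ⁺ + μ⁻` (same correlations,
Friedli–Velenik 2017, Lemma 3.19 and §3.7.1), so `μ = g·(μ⁺+μ⁻)` with `g ≤ 1`; the pieces `g·μ⁺`,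
`g·μ⁻` are DLR measures (the density is a.s. `𝓕_{Λᶜ}`-measurable for every `Λ`, Georgii 2011,
Thm. 7.7) dominated by `μ⁺`, `μ⁻`, hence equal to `t μ⁺`, `s μ⁻` by extremality (Friedli–Velenik
2017, Thm. 6.63), and `t + s = μ(Ω) = 1`. [cite: Lebowitz1977, §3, Thm. 3 and Remark (iii), p. 472] -/
theorem eq_mixture_of_even_spinCorr_eq {β : ℝ} (hβ : 0 ≤ β)
    {μp μm μ : Measure (SpinConfig (Site d))}
    (hμp : IsGibbsMeasure (isingSpecification (zdGraph d) β 0) μp)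
    (hp : ∀ A : Finset (Site d), spinCorr μp A = plusCorr d β 0 A)
    (hμm : IsGibbsMeasure (isingSpecification (zdGraph d) β 0) μm)
    (hm : ∀ A : Finset (Site d), spinCorr μm A = minusCorr d β 0 A)
    (hμ : IsGibbsMeasure (isingSpecification (zdGraph d) β 0) μ)
    (heven : ∀ A : Finset (Site d), Even #A → spinCorr μ A = plusCorr d β 0 A) :
    ∃ t : ℝ≥0∞, t ≤ 1 ∧ μ = t • μp + (1 - t) • μm := by
  classical
  haveI := hμp.isProbabilityMeasure
  haveI := hμm.isProbabilityMeasure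
  haveI := hμ.isProbabilityMeasure
  have hγ : IsSpecification (isingSpecification (zdGraph d) β 0) :=
    isSpecification_isingSpecification_holds (zdGraph d) β 0
  -- the flipped measure is Gibbs
  set ν : Measure (SpinConfig (Site d)) := μ.map fun σ : SpinConfig (Site d) => -σ with hνdef
  have hν : IsGibbsMeasure (isingSpecification (zdGraph d) β 0) ν :=
    isGibbsMeasure_map_neg (zdGraph d) β hμ
  haveI := hν.isProbabilityMeasure
  -- Step 1: `μ + μ∘flip⁻¹ = μ⁺ + μ⁻` by comparison of correlations
  have hcorr : ∀ A : Finset (Site d),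
      spinCorr μ A + spinCorr ν A = spinCorr μp A + spinCorr μm A := by
    intro A
    rw [hνdef, spinCorr_map_neg, hp, hm, minusCorr_eq_plusCorr_neg hβ 0 A, neg_zero]
    rcases Nat.even_or_odd #A with hA | hA
    · rw [heven A hA, hA.neg_one_pow]
    · rw [hA.neg_one_pow]
      ring
  have htwo : (2 : ℝ≥0∞) * 2⁻¹ = 1 := ENNReal.mul_inv_cancel two_ne_zero ENNReal.ofNat_ne_top
  have htwo' : (2 : ℝ≥0∞)⁻¹ * 2 = 1 := ENNReal.inv_mul_cancel two_ne_zero ENNReal.ofNat_ne_top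
  have hprob : ∀ (π π' : Measure (SpinConfig (Site d))) [IsProbabilityMeasure π]
      [IsProbabilityMeasure π'], IsProbabilityMeasure ((2 : ℝ≥0∞)⁻¹ • (π + π')) := by
    intro π π' _ _
    refine ⟨?_⟩
    rw [Measure.smul_apply, Measure.add_apply, measure_univ, measure_univ, smul_eq_mul,
      one_add_one_eq_two, htwo']
  haveI := hprob μ ν
  haveI := hprob μp μm
  have heq : (2 : ℝ≥0∞)⁻¹ • (μ + ν) = (2 : ℝ≥0∞)⁻¹ • (μp + μm) := by
    refine measure_eq_of_forall_spinCorr_eq _ _ fun A => ?_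
    rw [spinCorr_smul, spinCorr_smul, spinCorr_add, spinCorr_add, hcorr A]
  have hsum : μ + ν = μp + μm := by
    calc μ + ν = (2 : ℝ≥0∞) • ((2 : ℝ≥0∞)⁻¹ • (μ + ν)) := by rw [smul_smul, htwo, one_smul]
      _ = (2 : ℝ≥0∞) • ((2 : ℝ≥0∞)⁻¹ • (μp + μm)) := by rw [heq]
      _ = μp + μm := by rw [smul_smul, htwo, one_smul]
  -- Step 2: `μ ≤ ρ = μ⁺ + μ⁻`, and the density `g = dμ/dρ ≤ 1`
  have hle : μ ≤ μp + μm := by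
    rw [← hsum]
    exact Measure.le_add_right le_rfl
  set ρ : Measure (SpinConfig (Site d)) := μp + μm with hρdef
  haveI : IsFiniteMeasure ρ := by rw [hρdef]; infer_instance
  have hac : μ ≪ ρ := Measure.absolutelyContinuous_of_le hle
  set g : SpinConfig (Site d) → ℝ≥0∞ := μ.rnDeriv ρ with hgdef
  have hg : Measurable g := Measure.measurable_rnDeriv μ ρ
  haveI hsf : SFinite μ := inferInstance
  haveI hsg : SigmaFinite ρ := inferInstance
  haveI hld : μ.HaveLebesgueDecomposition ρ := inferInstance
  have hμρ : μ = ρ.withDensity g := (Measure.withDensity_rnDeriv_eq μ ρ hac).symm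
  have hg1 : g ≤ᵐ[ρ] 1 := Measure.rnDeriv_le_one_of_le hle
  have hρdlr : ∀ (Λ : Finset (Site d)) (A : Set (SpinConfig (Site d))), MeasurableSet A →
      ∫⁻ η, isingSpecification (zdGraph d) β 0 Λ η A ∂ρ = ρ A := fun Λ A hA => by
    rw [hρdef, lintegral_add_measure, Measure.add_apply, hμp.2 Λ A hA, hμm.2 Λ A hA]
  -- Step 3: the pieces `g·μ⁺`, `g·μ⁻` are DLR measures dominated by `μ⁺`, `μ⁻`
  have hpiece : ∀ π : Measure (SpinConfig (Site d)),
      IsGibbsMeasure (isingSpecification (zdGraph d) β 0) π → π ≤ ρ →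
        (∀ (Λ : Finset (Site d)) (A : Set (SpinConfig (Site d))), MeasurableSet A →
          ∫⁻ η, isingSpecification (zdGraph d) β 0 Λ η A ∂(π.withDensity g) = π.withDensity g A) ∧
        π.withDensity g ≤ π := by
    intro π hπ hπle
    refine ⟨hγ.dlr_withDensity_of_absolutelyContinuous hμ.2 hρdlr hπ.2
      (Measure.absolutelyContinuous_of_le hπle) hg hμρ, ?_⟩
    calc π.withDensity g ≤ π.withDensity 1 :=
          withDensity_mono ((Measure.absolutelyContinuous_of_le hπle).ae_le hg1)
      _ = π := withDensity_one
  obtain ⟨hκp, hκple⟩ := hpiece μp hμp (Measure.le_add_right le_rfl)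
  obtain ⟨hκm, hκmle⟩ := hpiece μm hμm (Measure.le_add_left le_rfl)
  have hp' := eq_smul_of_dlr_of_le_plus hβ 0 hμp hp hκp hκple
  have hm' := eq_smul_of_dlr_of_le_minus hβ 0 hμm hm hκm hκmle
  -- Step 4: assemble
  set t : ℝ≥0∞ := μp.withDensity g Set.univ with htdef
  set s : ℝ≥0∞ := μm.withDensity g Set.univ with hsdef
  have hdecomp : μ = t • μp + s • μm := by
    rw [hμρ, hρdef, withDensity_add_measure, ← hp', ← hm']
  have hts : t + s = 1 := by
    have huniv := congrArg (fun m : Measure (SpinConfig (Site d)) => m Set.univ) hdecomp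
    simp only [Measure.add_apply, Measure.smul_apply, smul_eq_mul, measure_univ, mul_one] at huniv
    exact huniv.symm
  have ht : t ≠ ∞ := ne_top_of_le_ne_top ENNReal.one_ne_top (hts ▸ le_self_add)
  refine ⟨t, hts ▸ le_self_add, ?_⟩
  rw [ENNReal.sub_eq_of_eq_add_rev ht hts.symm]
  exact hdecomp

/-- **The same, with the plus and minus states supplied** (Lebowitz 1977, §3, Thm. 3 / Remark
(iii); Friedli–Velenik 2017, Thm. 3.17, Thm. 6.26, Thm. 6.63): for `β ≥ 0`, every
`μ ∈ 𝒢(β, 0)` on `ℤ^d` whose even correlations are `⟨σ_A⟩⁺_{β,0}` is a mixture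
`t μ⁺ + (1-t) μ⁻`, `t ∈ [0,1]`, of the plus and minus states (the Gibbs measures with
correlations `plusCorr d β 0`, `minusCorr d β 0`, which exist by `exists_plusMeasure_holds`,
`exists_minusMeasure_holds`). [cite: Lebowitz1977, §3, Thm. 3 and Remark (iii), p. 472] -/
theorem exists_eq_mixture_of_even_spinCorr_eq_plusCorr {β : ℝ} (hβ : 0 ≤ β)
    {μ : Measure (SpinConfig (Site d))} (hμ : μ ∈ isingGibbsMeasures d β 0)
    (heven : ∀ A : Finset (Site d), Even #A → spinCorr μ A = plusCorr d β 0 A) :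
    ∃ μp μm : Measure (SpinConfig (Site d)),
      μp ∈ isingGibbsMeasures d β 0 ∧ μm ∈ isingGibbsMeasures d β 0 ∧
        (∀ A, spinCorr μp A = plusCorr d β 0 A) ∧ (∀ A, spinCorr μm A = minusCorr d β 0 A) ∧
          ∃ t : ℝ≥0∞, t ≤ 1 ∧ μ = t • μp + (1 - t) • μm := by
  obtain ⟨μp, hμp, -, hp⟩ := exists_plusMeasure_holds (d := d) (β := β) (h := 0) hβ
  obtain ⟨μm, hμm, -, hm⟩ := exists_minusMeasure_holds (d := d) (β := β) (h := 0) hβ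
  exact ⟨μp, μm, hμp, hμm, hp, hm,
    eq_mixture_of_even_spinCorr_eq hβ hμp hp hμm hm hμ heven⟩

end Mixture

end Literature.Probability.LatticeModels
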